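import Literature.Analysis.InverseSpectral.HelicalFunctionProofsConverse
import Literature.Analysis.InverseSpectral.HelicalFunctionProofsToeplitz
import HarnessLib

/-!
# Kreĭn's representation theorem: the representation on one lattice

Third file of the proof of `Literature.Analysis.InverseSpectral.KreinHelicalRepresentation`
(Arov–Dym 2012, Thm 9.1). Fix a mesh `h > 0`, a positive-definite sequence `D` on `ℤ` which agrees
with the second differences `2g(jh) - g((j+1)h) - g((j-1)h)` of the samples of `g` on a range of
`j`, and a Fejér measure `ν` of `D` (`exists_fejer_measure`). We prove:

* trigonometric inequalities: Jordan's bound `2 - 2cos y ≥ (4/π²) y²` on `|y| ≤ π`,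
  `1 - cos y ≥ y²/4` on `|y| ≤ 1`, the Dirichlet-kernel bound `|∑_{k≤K} cos ku| ≤ π/|u|`, and the
  two lower bounds for the averaged kernel `K⁻¹ ∑_{k≤K} (2 - 2cos ku)` (`≥ 1` for `K|u| ≥ 2π`,
  `≥ K²u²/6` for `K|u| ≤ 1`);
* the **lattice representation**: with the rescaled measure
  `ρ = (x²/((2 - 2cos hx)(1 + x²))) · (ν ∘ (θ ↦ θ/h)⁻¹)` and `F(t, x) = h(t, x)(1 + x²)`
  (`h = kreinHelicalIntegrand`),
  `g(kh) = g(0) + kh·A + ∫ F(kh, x) dρ(x) - R_k`, `|R_k| ≤ k³ D(0)/M`, `Re A = 0`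
  (`lattice_rep`, `lattice_rep_neg`, `re_latticeCoeff_eq_zero`);
* the **mass and tail bounds** for `ρ` in terms of the modulus of continuity of `g` at `0`
  (`measure_tail_le`, `measure_ball_le`), obtained from the real part of the representation by
  averaging over `k ≤ K`.

The compactness argument and the assembly are in `HelicalFunctionProofsLimit` and
`HelicalFunctionProofs`.

## References

* D. Z. Arov, H. Dym, *Bitangential direct and inverse problems…*, CUP 2012, Thm 9.1.
* M. G. Kreĭn, Dokl. Akad. Nauk SSSR 45 (1944) 139–142 (the helical extension theorem).
-/

open MeasureTheory Set Complex Filter Finset Literature.Analysis.FunctionSpaces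
open scoped ComplexConjugate ENNReal NNReal Topology BigOperators ComplexOrder

noncomputable section

namespace Literature.Analysis.InverseSpectral

/-! ### Trigonometric inequalities -/

/-- Jordan-type bound: `(4/π²) y² ≤ 2 - 2cos y` for `|y| ≤ π`. [folklore] -/
theorem sq_le_two_sub_two_cos {y : ℝ} (hy : |y| ≤ Real.pi) :
    4 / Real.pi ^ 2 * y ^ 2 ≤ 2 - 2 * Real.cos y := by
  -- reduce to `0 ≤ y`
  wlog h0 : 0 ≤ y generalizing y
  · have h := this (y := -y) (by rwa [abs_neg]) (by linarith [le_of_not_ge h0])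
    simpa [Real.cos_neg] using h
  have hy' : y ≤ Real.pi := (le_abs_self y).trans hy
  have hcos : Real.cos y = 2 * Real.cos (y / 2) ^ 2 - 1 := by
    rw [← Real.cos_two_mul]; ring_nf
  have hsin : Real.sin (y / 2) ^ 2 = 1 - Real.cos (y / 2) ^ 2 := Real.sin_sq _
  have hj : 2 / Real.pi * (y / 2) ≤ Real.sin (y / 2) :=
    Real.mul_le_sin (by linarith) (by linarith)
  have hj0 : 0 ≤ 2 / Real.pi * (y / 2) := by positivity
  have hsq : (2 / Real.pi * (y / 2)) ^ 2 ≤ Real.sin (y / 2) ^ 2 := pow_le_pow_left₀ hj0 hj 2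
  have hpi : Real.pi ≠ 0 := Real.pi_ne_zero
  have : (2 / Real.pi * (y / 2)) ^ 2 = y ^ 2 / Real.pi ^ 2 := by field_simp
  rw [this] at hsq
  have : 4 / Real.pi ^ 2 * y ^ 2 = 4 * (y ^ 2 / Real.pi ^ 2) := by ring
  rw [this]
  nlinarith

/-- `y²/4 ≤ 1 - cos y` for `|y| ≤ 1` (from Mathlib's `Real.cos_bound`). [folklore] -/
theorem sq_div_four_le_one_sub_cos {y : ℝ} (hy : |y| ≤ 1) : y ^ 2 / 4 ≤ 1 - Real.cos y := by
  have h := Real.cos_bound hy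
  have h4 : |y| ^ 4 ≤ |y| ^ 2 := pow_le_pow_of_le_one (abs_nonneg _) hy (by norm_num)
  rw [abs_le] at h
  have h2 : |y| ^ 2 = y ^ 2 := sq_abs y
  rw [h2] at h4
  nlinarith [h.1, h.2, sq_nonneg y]

/-- The telescoping identity behind the Dirichlet kernel:
`2 sin(u/2) ∑_{k<K} cos((k+1)u) = sin((K + 1/2)u) - sin(u/2)`. [folklore] -/
theorem two_mul_sin_mul_sum_cos (u : ℝ) (K : ℕ) :
    2 * Real.sin (u / 2) * ∑ k ∈ Finset.range K, Real.cos ((k + 1) * u) =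
      Real.sin ((K + 1 / 2) * u) - Real.sin (u / 2) := by
  induction K with
  | zero => simp; ring_nf
  | succ K ih =>
    rw [Finset.sum_range_succ, mul_add, ih]
    have h : 2 * Real.sin (u / 2) * Real.cos ((K + 1) * u) =
        Real.sin (((K + 1 : ℕ) : ℝ) * u + u / 2) - Real.sin ((K + 1 / 2) * u) := by
      have h1 : ((K + 1 : ℕ) : ℝ) * u + u / 2 = u / 2 + (K + 1) * u := by push_cast; ring
      have h2 : (K + 1 / 2) * u = (K + 1) * u - u / 2 := by ring
      rw [h1, h2, Real.sin_add, Real.sin_sub]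
      ring
    rw [h]
    push_cast
    ring_nf

/-- **Dirichlet-kernel bound**: `|∑_{k<K} cos((k+1)u)| ≤ π/|u|` for `0 < |u| ≤ π`. [folklore] -/
theorem abs_sum_cos_le {u : ℝ} (hu0 : u ≠ 0) (hu : |u| ≤ Real.pi) (K : ℕ) :
    |∑ k ∈ Finset.range K, Real.cos ((k + 1) * u)| ≤ Real.pi / |u| := by
  -- `|sin (u/2)| ≥ |u|/π`
  have hsin : |u| / Real.pi ≤ |Real.sin (u / 2)| := by
    wlog h0 : 0 ≤ u generalizing u
    · have h := this (u := -u) (neg_ne_zero.2 hu0) (by rwa [abs_neg]) (by linarith [le_of_not_ge h0])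
      rwa [abs_neg, neg_div, Real.sin_neg, abs_neg] at h
    have hu' : u ≤ Real.pi := (le_abs_self u).trans hu
    have hj : 2 / Real.pi * (u / 2) ≤ Real.sin (u / 2) :=
      Real.mul_le_sin (by linarith) (by linarith)
    rw [abs_of_nonneg h0]
    have : 2 / Real.pi * (u / 2) = u / Real.pi := by ring
    rw [this] at hj
    exact hj.trans (le_abs_self _)
  have hpos : 0 < |u| / Real.pi := by positivity
  have hsin0 : 0 < |Real.sin (u / 2)| := lt_of_lt_of_le hpos hsin
  have hid := two_mul_sin_mul_sum_cos u K
  have hbound : |2 * Real.sin (u / 2) * ∑ k ∈ Finset.range K, Real.cos ((k + 1) * u)| ≤ 2 := by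
    rw [hid]
    have h1 := Real.abs_sin_le_one ((K + 1 / 2) * u)
    have h2 := Real.abs_sin_le_one (u / 2)
    calc |Real.sin ((K + 1 / 2) * u) - Real.sin (u / 2)|
        ≤ |Real.sin ((K + 1 / 2) * u)| + |Real.sin (u / 2)| := abs_sub _ _
      _ ≤ 2 := by linarith
  rw [abs_mul, abs_mul, abs_two] at hbound
  have h3 : |∑ k ∈ Finset.range K, Real.cos ((k + 1) * u)| ≤ 1 / |Real.sin (u / 2)| := by
    rw [le_div_iff₀ hsin0]
    nlinarith
  calc |∑ k ∈ Finset.range K, Real.cos ((k + 1) * u)| ≤ 1 / |Real.sin (u / 2)| := h3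
    _ ≤ 1 / (|u| / Real.pi) := one_div_le_one_div_of_le hpos hsin
    _ = Real.pi / |u| := by rw [one_div_div]

/-- **Averaged kernel, tail regime**: `1 ≤ K⁻¹ ∑_{k<K} (2 - 2cos((k+1)u))` when `0 < |u| ≤ π`
and `2π ≤ K |u|`. [folklore] -/
theorem one_le_avg_kernel {u : ℝ} (hu0 : u ≠ 0) (hu : |u| ≤ Real.pi) {K : ℕ} (hK : 0 < K)
    (hKu : 2 * Real.pi ≤ K * |u|) :
    1 ≤ (K : ℝ)⁻¹ * ∑ k ∈ Finset.range K, (2 - 2 * Real.cos ((k + 1) * u)) := by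
  have hsum : ∑ k ∈ Finset.range K, (2 - 2 * Real.cos ((k + 1) * u)) =
      2 * K - 2 * ∑ k ∈ Finset.range K, Real.cos ((k + 1) * u) := by
    rw [Finset.sum_sub_distrib, Finset.sum_const, Finset.card_range, ← Finset.mul_sum, nsmul_eq_mul]
    ring
  rw [hsum]
  have hb := abs_sum_cos_le hu0 hu K
  have hle : ∑ k ∈ Finset.range K, Real.cos ((k + 1) * u) ≤ Real.pi / |u| := (le_abs_self _).trans hb
  have hK' : (0 : ℝ) < K := by exact_mod_cast hK
  have hupos : 0 < |u| := abs_pos.2 hu0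
  -- `π/|u| ≤ K/2`
  have hpu : Real.pi / |u| ≤ K / 2 := by
    rw [div_le_iff₀ hupos]; linarith
  rw [← div_eq_inv_mul, le_div_iff₀ hK']
  linarith

/-- `∑_{k<K} (k+1)² ≥ K³/3`. [folklore] -/
theorem cube_div_three_le_sum_sq (K : ℕ) :
    (K : ℝ) ^ 3 / 3 ≤ ∑ k ∈ Finset.range K, ((k : ℝ) + 1) ^ 2 := by
  induction K with
  | zero => simp
  | succ K ih =>
    rw [Finset.sum_range_succ]
    push_cast
    have hK0 : (0 : ℝ) ≤ K := K.cast_nonneg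
    nlinarith [ih, hK0]

/-- **Averaged kernel, central regime**: `K²u²/6 ≤ K⁻¹ ∑_{k<K} (2 - 2cos((k+1)u))` when
`K |u| ≤ 1`. [folklore] -/
theorem sq_le_avg_kernel {u : ℝ} {K : ℕ} (hK : 0 < K) (hKu : K * |u| ≤ 1) :
    (K : ℝ) ^ 2 * u ^ 2 / 6 ≤ (K : ℝ)⁻¹ * ∑ k ∈ Finset.range K, (2 - 2 * Real.cos ((k + 1) * u)) := by
  have hK' : (0 : ℝ) < K := by exact_mod_cast hK
  have hterm : ∀ k ∈ Finset.range K, ((k : ℝ) + 1) ^ 2 * u ^ 2 / 2 ≤ 2 - 2 * Real.cos ((k + 1) * u) := by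
    intro k hk
    rw [Finset.mem_range] at hk
    have hk1 : ((k : ℝ) + 1) ≤ K := by exact_mod_cast hk
    have habs : |((k : ℝ) + 1) * u| ≤ 1 := by
      rw [abs_mul, abs_of_nonneg (by positivity : (0 : ℝ) ≤ k + 1)]
      calc ((k : ℝ) + 1) * |u| ≤ K * |u| := by gcongr
        _ ≤ 1 := hKu
    have h := sq_div_four_le_one_sub_cos habs
    nlinarith
  have hsum := Finset.sum_le_sum hterm
  have hcube := cube_div_three_le_sum_sq K
  have hs : ∑ k ∈ Finset.range K, ((k : ℝ) + 1) ^ 2 * u ^ 2 / 2 =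
      (u ^ 2 / 2) * ∑ k ∈ Finset.range K, ((k : ℝ) + 1) ^ 2 := by
    rw [Finset.mul_sum]
    exact Finset.sum_congr rfl fun k _ => by ring
  rw [hs] at hsum
  rw [← div_eq_inv_mul, le_div_iff₀ hK']
  have hu2 : 0 ≤ u ^ 2 / 2 := by positivity
  nlinarith [mul_le_mul_of_nonneg_left hcube hu2]

/-! ### Conventions for one lattice level

Throughout, `h > 0` is the mesh, `ν` a Fejér measure (finite, absolutely continuous, carried by
`(-π, π]`), and the following expressions recur (written out in full in every statement, so that
no auxiliary definitions are introduced):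

* `F(t, x) = h(t, x) (1 + x²)`, i.e. `kreinHelicalIntegrand t x * (1 + x²)` — the bounded
  continuous integrand of the final representation;
* `Q(k, θ) = (e^{-ikθ} - 1 - k(1 - e^{iθ}))/(2 - 2cos θ)` — the summed geometric kernel;
* `μ_h(θ) = ((1 - e^{iθ}) + iθ/(1 + (θ/h)²))/(2 - 2cos θ)` — the compensator mismatch;
* `P_h(t, θ) = h(t, θ/h) (θ/h)²/(2 - 2cos θ)` — `F` transported to the `θ`-variable;
* `ρ_h = (x²/((2 - 2cos hx)(1 + x²))) · (θ ↦ θ/h)_* ν` — the rescaled measure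
  (`Measure.withDensity` of `Measure.map`).
-/

/-! ### Pointwise identities on the good set `θ ∈ (-π, π]`, `θ ≠ 0` -/

section Pointwise

/-- On `(-π, π] ∖ {0}`: `(4/π²) θ² ≤ 2 - 2cos θ` and `0 < 2 - 2cos θ`. [folklore] -/
lemma two_sub_two_cos_pos_of_mem {θ : ℝ} (hθ : θ ∈ Set.Ioc (-Real.pi) Real.pi) (h0 : θ ≠ 0) :
    4 / Real.pi ^ 2 * θ ^ 2 ≤ 2 - 2 * Real.cos θ ∧ 0 < 2 - 2 * Real.cos θ := by
  have habs : |θ| ≤ Real.pi := abs_le.2 ⟨hθ.1.le, hθ.2⟩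
  have h1 := sq_le_two_sub_two_cos habs
  refine ⟨h1, lt_of_lt_of_le ?_ h1⟩
  have : 0 < θ ^ 2 := by positivity
  positivity

/-- `(θ/h)²/(2 - 2cos θ) ≤ π²/(4h²)` on the good set. [folklore] -/
lemma sq_div_two_sub_two_cos_le {θ h : ℝ} (hh : 0 < h) (hθ : θ ∈ Set.Ioc (-Real.pi) Real.pi)
    (h0 : θ ≠ 0) : (θ / h) ^ 2 / (2 - 2 * Real.cos θ) ≤ Real.pi ^ 2 / (4 * h ^ 2) := by
  obtain ⟨hc, hcpos⟩ := two_sub_two_cos_pos_of_mem hθ h0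
  rw [div_le_div_iff₀ hcpos (by positivity)]
  have hθ2 : 0 < θ ^ 2 := by positivity
  have : (θ / h) ^ 2 * (4 * h ^ 2) = 4 * θ ^ 2 := by field_simp
  rw [this]
  have hpi : (0 : ℝ) < Real.pi ^ 2 := by positivity
  have := mul_le_mul_of_nonneg_left hc hpi.le
  have h3 : Real.pi ^ 2 * (4 / Real.pi ^ 2 * θ ^ 2) = 4 * θ ^ 2 := by field_simp
  linarith

/-- The transported integrand: `P_h(kh, θ) = (e^{-ikθ} - 1 + ikθ/(1 + (θ/h)²))/(2 - 2cos θ)` for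
`θ ≠ 0`. [folklore] -/
lemma transported_eq {θ h : ℝ} (hh : 0 < h) (h0 : θ ≠ 0) (k : ℤ) :
    (kreinHelicalIntegrand (k * h) ((θ) / (h)) * ((((θ) / (h)) ^ 2 / ((2 : ℝ) - 2 * Real.cos (θ)) : ℝ) : ℂ)) = (cexp (-(I * (k : ℂ) * (θ : ℂ))) - 1 +
      I * (k : ℂ) * (θ : ℂ) / (((1 : ℝ) + (θ / h) ^ 2 : ℝ) : ℂ)) /
        (((2 : ℝ) - 2 * Real.cos θ : ℝ) : ℂ) := by
  have hx : θ / h ≠ 0 := div_ne_zero h0 hh.ne'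
  rw [kreinHelicalIntegrand_of_ne_zero _ hx]
  set x : ℝ := θ / h with hxdef
  set c : ℝ := 2 - 2 * Real.cos θ with hcdef
  have hxt : (x : ℂ) * (((k : ℝ) * h : ℝ) : ℂ) = (k : ℂ) * (θ : ℂ) := by
    have hh' : (h : ℂ) ≠ 0 := Complex.ofReal_ne_zero.2 hh.ne'
    rw [hxdef]; push_cast; field_simp
  have hlin : I * (x : ℂ) * (((k : ℝ) * h : ℝ) : ℂ) = I * (k : ℂ) * (θ : ℂ) := by
    rw [mul_assoc, hxt, ← mul_assoc]
  rw [hlin]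
  have hq : (((1 : ℝ) + x ^ 2 : ℝ) : ℂ) = 1 + (x : ℂ) ^ 2 := by push_cast; ring
  rw [hq]
  have hx' : (x : ℂ) ≠ 0 := Complex.ofReal_ne_zero.2 hx
  by_cases hc : c = 0
  · rw [hc]; simp
  · have hc' : (c : ℂ) ≠ 0 := Complex.ofReal_ne_zero.2 hc
    rw [show ((x ^ 2 / c : ℝ) : ℂ) = (x : ℂ) ^ 2 / (c : ℂ) by push_cast; ring]
    field_simp

/-- **Key pointwise identity**: `Q(k, θ) = P_h(kh, θ) - k μ_h(θ)` for `θ ≠ 0`. [folklore] -/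
lemma kernel_eq_transported_sub {θ h : ℝ} (hh : 0 < h) (h0 : θ ≠ 0) (k : ℤ) :
    ((cexp (-(I * ((k) : ℂ) * ((θ) : ℂ))) - 1 - ((k) : ℂ) * (1 - cexp (I * ((θ) : ℂ)))) / (((2 : ℝ) - 2 * Real.cos (θ) : ℝ) : ℂ)) = (kreinHelicalIntegrand (k * h) ((θ) / (h)) * ((((θ) / (h)) ^ 2 / ((2 : ℝ) - 2 * Real.cos (θ)) : ℝ) : ℂ)) - (k : ℂ) * (((1 - cexp (I * ((θ) : ℂ))) + I * ((θ) : ℂ) / (((1 : ℝ) + ((θ) / (h)) ^ 2 : ℝ) : ℂ)) / (((2 : ℝ) - 2 * Real.cos (θ) : ℝ) : ℂ)) := by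
  rw [transported_eq hh h0 k]
  by_cases hc : (2 : ℝ) - 2 * Real.cos θ = 0
  · rw [hc]; simp
  · have hc' : (((2 : ℝ) - 2 * Real.cos θ : ℝ) : ℂ) ≠ 0 := Complex.ofReal_ne_zero.2 hc
    have h1 : (((1 : ℝ) + (θ / h) ^ 2 : ℝ) : ℂ) ≠ 0 := by
      have : (((1 : ℝ) + (θ / h) ^ 2 : ℝ) : ℂ) = 1 + ((θ / h : ℝ) : ℂ) ^ 2 := by push_cast; ring
      rw [this]; exact one_add_sq_ne_zero _
    field_simp
    ring

/-- `Q(1, θ) = -1` on the good set (and `0` where `cos θ = 1`); hence `‖Q(1, θ)‖ ≤ 1`. [folklore] -/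
lemma norm_kernel_one_le (θ : ℝ) : ‖((cexp (-(I * (((1 : ℤ)) : ℂ) * ((θ) : ℂ))) - 1 - (((1 : ℤ)) : ℂ) * (1 - cexp (I * ((θ) : ℂ)))) / (((2 : ℝ) - 2 * Real.cos (θ) : ℝ) : ℂ))‖ ≤ 1 := by
  by_cases hc : (2 : ℝ) - 2 * Real.cos θ = 0
  · rw [hc]; simp
  · have hc' : (((2 : ℝ) - 2 * Real.cos θ : ℝ) : ℂ) ≠ 0 := Complex.ofReal_ne_zero.2 hc
    have hnum : cexp (-(I * ((1 : ℤ) : ℂ) * (θ : ℂ))) - 1 - ((1 : ℤ) : ℂ) * (1 - cexp (I * (θ : ℂ))) =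
        -(((2 : ℝ) - 2 * Real.cos θ : ℝ) : ℂ) := by
      push_cast
      rw [Complex.cos]
      ring_nf
    rw [hnum, neg_div, div_self hc', norm_neg, norm_one]

/-- `Re μ_h(θ) = 1/2` on the good set. [folklore] -/
lemma re_compensator_eq {θ h : ℝ} (hθ : θ ∈ Set.Ioc (-Real.pi) Real.pi) (h0 : θ ≠ 0) :
    ((((1 - cexp (I * ((θ) : ℂ))) + I * ((θ) : ℂ) / (((1 : ℝ) + ((θ) / (h)) ^ 2 : ℝ) : ℂ)) / (((2 : ℝ) - 2 * Real.cos (θ) : ℝ) : ℂ))).re = 1 / 2 := by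
  obtain ⟨-, hcpos⟩ := two_sub_two_cos_pos_of_mem hθ h0
  rw [Complex.div_ofReal_re]
  have hnum : ((1 - cexp (I * (θ : ℂ))) + I * (θ : ℂ) / (((1 : ℝ) + (θ / h) ^ 2 : ℝ) : ℂ)).re =
      1 - Real.cos θ := by
    rw [Complex.add_re, Complex.div_ofReal_re, Complex.sub_re, Complex.one_re]
    simp [Complex.exp_re]
  rw [hnum, div_eq_iff hcpos.ne']
  ring

/-- The summed geometric kernel is `-Q(k, θ)` on the good set:
`∑_{i<k} (k - i) e^{-iiθ} = -Q(k, θ)`. [folklore] -/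
lemma sum_geom_kernel_eq {θ : ℝ} (hθ : θ ∈ Set.Ioc (-Real.pi) Real.pi) (h0 : θ ≠ 0) (k : ℕ) :
    ∑ i ∈ Finset.range k, ((k : ℂ) - i) * cexp (-(I * (i : ℂ) * (θ : ℂ))) = -((cexp (-(I * (((k : ℤ)) : ℂ) * ((θ) : ℂ))) - 1 - (((k : ℤ)) : ℂ) * (1 - cexp (I * ((θ) : ℂ)))) / (((2 : ℝ) - 2 * Real.cos (θ) : ℝ) : ℂ)) := by
  obtain ⟨-, hcpos⟩ := two_sub_two_cos_pos_of_mem hθ h0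
  have hc' : (((2 : ℝ) - 2 * Real.cos θ : ℝ) : ℂ) ≠ 0 := Complex.ofReal_ne_zero.2 hcpos.ne'
  set z : ℂ := cexp (-(I * (θ : ℂ))) with hz
  set w : ℂ := cexp (I * (θ : ℂ)) with hw
  have hzw : z * w = 1 := by rw [hz, hw, ← Complex.exp_add]; simp
  have hpow : ∀ i : ℕ, cexp (-(I * (i : ℂ) * (θ : ℂ))) = z ^ i := by
    intro i
    rw [hz, ← Complex.exp_nat_mul]; ring_nf
  have hcz : (((2 : ℝ) - 2 * Real.cos θ : ℝ) : ℂ) = 2 - z - w := by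
    push_cast
    rw [Complex.cos, hz, hw]
    ring_nf
  have hclosed := kernel_sum_closed_form z w hzw k
  have hzk : cexp (-(I * ((k : ℤ) : ℂ) * (θ : ℂ))) = z ^ k := by
    rw [hz, ← Complex.exp_nat_mul]; push_cast; ring_nf
  simp_rw [hpow]
  rw [hzk, ← neg_div, eq_div_iff hc', hcz]
  push_cast
  linear_combination hclosed

end Pointwise

/-! ### Integrability on one lattice level -/

section Level

variable {h : ℝ} {ν : Measure ℝ}

/-- `ν`-almost every `θ` lies in the good set. [folklore] -/
lemma ae_good (hac : ν ≪ volume) (hsupp : ν (Set.Ioc (-Real.pi) Real.pi)ᶜ = 0) :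
    ∀ᵐ θ ∂ν, θ ∈ Set.Ioc (-Real.pi) Real.pi ∧ θ ≠ 0 := by
  have h1 : ∀ᵐ θ ∂ν, θ ∈ Set.Ioc (-Real.pi) Real.pi := by
    rw [ae_iff]
    simpa only [Set.compl_def] using hsupp
  have h2 : ∀ᵐ θ ∂ν, θ ∉ ({0} : Set ℝ) :=
    (measure_eq_zero_iff_ae_notMem (μ := ν)).1 (hac Real.volume_singleton)
  filter_upwards [h1, h2] with θ hθ hθ0
  exact ⟨hθ, fun h => hθ0 (by simp [h])⟩

/-- Measurability of the transported integrand. [folklore] -/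
lemma measurable_transported (h t : ℝ) : Measurable fun θ : ℝ => (kreinHelicalIntegrand (t) ((θ) / (h)) * ((((θ) / (h)) ^ 2 / ((2 : ℝ) - 2 * Real.cos (θ)) : ℝ) : ℂ)) := by
  have h1 : Measurable fun θ : ℝ => kreinHelicalIntegrand t (θ / h) :=
    (measurable_kreinHelicalIntegrand t).comp (measurable_id.div_const h)
  exact h1.mul (by fun_prop)

/-- Measurability of the compensator mismatch. [folklore] -/
lemma measurable_compensator (h : ℝ) : Measurable fun θ : ℝ => (((1 - cexp (I * ((θ) : ℂ))) + I * ((θ) : ℂ) / (((1 : ℝ) + ((θ) / (h)) ^ 2 : ℝ) : ℂ)) / (((2 : ℝ) - 2 * Real.cos (θ) : ℝ) : ℂ)) := by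
  fun_prop

/-- Measurability of the summed kernel. [folklore] -/
lemma measurable_kernel (k : ℤ) : Measurable fun θ : ℝ => ((cexp (-(I * ((k) : ℂ) * ((θ) : ℂ))) - 1 - ((k) : ℂ) * (1 - cexp (I * ((θ) : ℂ)))) / (((2 : ℝ) - 2 * Real.cos (θ) : ℝ) : ℂ)) := by
  fun_prop

/-- A.e. bound for the transported integrand: `‖P_h(t, θ)‖ ≤ (2t² + 2|t| + 4) π²/(4h²)`. [folklore] -/
lemma norm_transported_le {θ : ℝ} (hh : 0 < h) (hθ : θ ∈ Set.Ioc (-Real.pi) Real.pi) (h0 : θ ≠ 0)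
    (t : ℝ) : ‖(kreinHelicalIntegrand (t) ((θ) / (h)) * ((((θ) / (h)) ^ 2 / ((2 : ℝ) - 2 * Real.cos (θ)) : ℝ) : ℂ))‖ ≤ (2 * t ^ 2 + 2 * |t| + 4) * (Real.pi ^ 2 / (4 * h ^ 2)) := by
  rw [norm_mul, Complex.norm_real, Real.norm_eq_abs]
  have h1 := norm_kreinHelicalIntegrand_le t (θ / h)
  have h2 : ‖kreinHelicalIntegrand t (θ / h)‖ ≤ 2 * t ^ 2 + 2 * |t| + 4 := by
    refine h1.trans (div_le_self (by positivity) ?_)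
    nlinarith [sq_nonneg (θ / h)]
  have h3 : |(θ / h) ^ 2 / (2 - 2 * Real.cos θ)| ≤ Real.pi ^ 2 / (4 * h ^ 2) := by
    obtain ⟨-, hcpos⟩ := two_sub_two_cos_pos_of_mem hθ h0
    rw [abs_of_nonneg (div_nonneg (sq_nonneg _) hcpos.le)]
    exact sq_div_two_sub_two_cos_le hh hθ h0
  exact mul_le_mul h2 h3 (abs_nonneg _) (by positivity)

/-- A.e. bound for the compensator mismatch: `‖μ_h(θ)‖ ≤ (2h² + 2h + 4) π²/(4h²) + 1`
(`μ_h = P_h(h, ·) - Q(1, ·)` and `‖Q(1, ·)‖ ≤ 1`). [folklore] -/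
lemma norm_compensator_le' {θ : ℝ} (hh : 0 < h) (hθ : θ ∈ Set.Ioc (-Real.pi) Real.pi) (h0 : θ ≠ 0) :
    ‖(((1 - cexp (I * ((θ) : ℂ))) + I * ((θ) : ℂ) / (((1 : ℝ) + ((θ) / (h)) ^ 2 : ℝ) : ℂ)) / (((2 : ℝ) - 2 * Real.cos (θ) : ℝ) : ℂ))‖ ≤ (2 * h ^ 2 + 2 * |h| + 4) * (Real.pi ^ 2 / (4 * h ^ 2)) + 1 := by
  have hid := kernel_eq_transported_sub hh h0 (1 : ℤ)
  have hμ : (((1 - cexp (I * ((θ) : ℂ))) + I * ((θ) : ℂ) / (((1 : ℝ) + ((θ) / (h)) ^ 2 : ℝ) : ℂ)) / (((2 : ℝ) - 2 * Real.cos (θ) : ℝ) : ℂ)) = (kreinHelicalIntegrand ((1 : ℤ) * h) ((θ) / (h)) * ((((θ) / (h)) ^ 2 / ((2 : ℝ) - 2 * Real.cos (θ)) : ℝ) : ℂ)) - ((cexp (-(I * (((1 : ℤ)) : ℂ) * ((θ) : ℂ))) - 1 - (((1 : ℤ)) : ℂ) * (1 - cexp (I * ((θ) : ℂ)))) / (((2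 : ℝ) - 2 * Real.cos (θ) : ℝ) : ℂ)) := by
    rw [hid]; push_cast; ring
  rw [hμ]
  refine (norm_sub_le _ _).trans (add_le_add ?_ (norm_kernel_one_le θ))
  have := norm_transported_le hh hθ h0 ((1 : ℤ) * h)
  simpa using this

variable [IsFiniteMeasure ν]

/-- Integrability of the transported integrand against `ν`. [folklore] -/
lemma integrable_transported (hh : 0 < h) (hac : ν ≪ volume)
    (hsupp : ν (Set.Ioc (-Real.pi) Real.pi)ᶜ = 0) (t : ℝ) :
    Integrable (fun θ : ℝ => (kreinHelicalIntegrand (t) ((θ) / (h)) * ((((θ) / (h)) ^ 2 / ((2 : ℝ) - 2 * Real.cos (θ)) : ℝ) : ℂ))) ν := by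
  refine Integrable.mono' (integrable_const ((2 * t ^ 2 + 2 * |t| + 4) * (Real.pi ^ 2 / (4 * h ^ 2))))
    (measurable_transported h t).aestronglyMeasurable ?_
  filter_upwards [ae_good hac hsupp] with θ hθ
  exact norm_transported_le hh hθ.1 hθ.2 t

/-- Integrability of the compensator mismatch against `ν`. [folklore] -/
lemma integrable_compensator (hh : 0 < h) (hac : ν ≪ volume)
    (hsupp : ν (Set.Ioc (-Real.pi) Real.pi)ᶜ = 0) :
    Integrable (fun θ : ℝ => (((1 - cexp (I * ((θ) : ℂ))) + I * ((θ) : ℂ) / (((1 : ℝ) + ((θ) / (h)) ^ 2 : ℝ) : ℂ)) / (((2 : ℝ) - 2 * Real.cos (θ) : ℝ) : ℂ))) ν := by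
  refine Integrable.mono'
    (integrable_const ((2 * h ^ 2 + 2 * |h| + 4) * (Real.pi ^ 2 / (4 * h ^ 2)) + 1))
    (measurable_compensator h).aestronglyMeasurable ?_
  filter_upwards [ae_good hac hsupp] with θ hθ
  exact norm_compensator_le' hh hθ.1 hθ.2

/-- `‖e^{-iiθ}‖ = 1` for real `i, θ`. [folklore] -/
lemma norm_cexp_neg_I_mul (i θ : ℝ) : ‖cexp (-(I * (i : ℂ) * (θ : ℂ)))‖ = 1 := by
  have : -(I * (i : ℂ) * (θ : ℂ)) = ((-(i * θ) : ℝ) : ℂ) * I := by push_cast; ring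
  rw [this, Complex.norm_exp_ofReal_mul_I]

/-- Integrability of `θ ↦ e^{-iiθ}` (norm one) against a finite measure. [folklore] -/
lemma integrable_cexp_neg (i : ℕ) : Integrable (fun θ : ℝ => cexp (-(I * (i : ℂ) * (θ : ℂ)))) ν := by
  refine Integrable.mono' (integrable_const (1 : ℝ))
    (by fun_prop : Continuous fun θ : ℝ => cexp (-(I * (i : ℂ) * (θ : ℂ)))).aestronglyMeasurable
    (ae_of_all _ fun θ => ?_)
  have := norm_cexp_neg_I_mul (i : ℝ) θ
  rw [← this]
  push_cast
  exact le_rfl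

/-! ### The representation on one lattice level -/

omit [IsFiniteMeasure ν] in
/-- Transport of `F` to the `θ`-variable: `∫ P_h(t, θ) dν(θ) = ∫ F(t, x) dρ_h(x)`. [folklore] -/
lemma integral_transported_eq (hh : 0 < h) (t : ℝ) :
    ∫ θ, (kreinHelicalIntegrand (t) ((θ) / (h)) * ((((θ) / (h)) ^ 2 / ((2 : ℝ) - 2 * Real.cos (θ)) : ℝ) : ℂ)) ∂ν = ∫ x, (kreinHelicalIntegrand (t) (x) * (((1 : ℝ) + (x) ^ 2 : ℝ) : ℂ)) ∂((MeasureTheory.Measure.withDensity (MeasureTheory.Measure.map (fun θ : ℝ => θ / (h)) (ν)) (fun x : ℝ => ENNReal.ofReal (x ^ 2 / (((2 : ℝ) - 2 * Real.cos ((h) * x)) * (1 + x ^ 2)))))) := by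
  rw [integral_withDensity_eq_integral_toReal_smul (Measurable.ennreal_ofReal (by fun_prop))
    (ae_of_all _ fun x => ENNReal.ofReal_lt_top)]
  rw [integral_map (by fun_prop : AEMeasurable (fun θ : ℝ => θ / h) ν)]
  · refine integral_congr_ae (ae_of_all _ fun θ => ?_)
    dsimp only
    have hθ : h * (θ / h) = θ := by field_simp
    simp only [hθ]
    have hr : 0 ≤ (θ / h) ^ 2 / ((2 - 2 * Real.cos θ) * (1 + (θ / h) ^ 2)) :=
      div_nonneg (sq_nonneg _) (mul_nonneg (by linarith [Real.cos_le_one θ]) (by positivity))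
    rw [ENNReal.toReal_ofReal hr, Complex.real_smul]
    conv_rhs => rw [← mul_assoc, mul_comm _ (kreinHelicalIntegrand t (θ / h)), mul_assoc,
      ← Complex.ofReal_mul]
    congr 1
    rw [Complex.ofReal_inj]
    by_cases hc : (2 : ℝ) - 2 * Real.cos θ = 0
    · rw [hc]; simp
    · have h1 : (1 : ℝ) + (θ / h) ^ 2 ≠ 0 := by positivity
      field_simp
  · exact ((Measurable.ennreal_toReal (Measurable.ennreal_ofReal (by fun_prop))).smul
      ((measurable_kreinHelicalIntegrand t).mul (by fun_prop))).aestronglyMeasurable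

/-- **Lattice representation.** On one lattice level, for `0 ≤ k ≤ M` such that the data `D`
agree with the second differences of `j ↦ g(jh)` for `j < k`:
`g(kh) = g(0) + kh·A_h + ∫ F(kh, x) dρ_h(x) - R_k` with `|R_k| ≤ k³ D(0)/M`, where
`A_h = ((g(0) - g(-h)) - ∫ μ_h dν)/h`. (Telescoping, Fejér coefficients, the closed form of the
summed geometric kernel, and the transport `Q = P - kμ`.) [folklore] -/
theorem lattice_rep {g : ℝ → ℂ} {D : ℤ → ℂ} {M : ℕ} (hh : 0 < h) (hD : IsPositiveDefinite D)
    (hM : 0 < M) (hac : ν ≪ volume) (hsupp : ν (Set.Ioc (-Real.pi) Real.pi)ᶜ = 0)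
    (hcoef : ∀ j : ℤ, j.natAbs ≤ M →
      ∫ θ, cexp (-(I * j * θ)) ∂ν = ((M - j.natAbs : ℕ) : ℂ) / M * D j)
    {k : ℕ} (hkM : k ≤ M)
    (hDd : ∀ j : ℕ, j < k → D j = 2 * g (j * h) - g ((j + 1) * h) - g ((j - 1) * h)) :
    ‖g (k * h) - (g 0 + ((k * h : ℝ) : ℂ) * (((g 0 - g (-h)) - ∫ θ, (((1 - cexp (I * ((θ) : ℂ))) + I * ((θ) : ℂ) / (((1 : ℝ) + ((θ) / (h)) ^ 2 : ℝ) : ℂ)) / (((2 : ℝ) - 2 * Real.cos (θ) : ℝ) : ℂ)) ∂ν) / h) +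
        ∫ x, (kreinHelicalIntegrand (k * h) (x) * (((1 : ℝ) + (x) ^ 2 : ℝ) : ℂ)) ∂((MeasureTheory.Measure.withDensity (MeasureTheory.Measure.map (fun θ : ℝ => θ / (h)) (ν)) (fun x : ℝ => ENNReal.ofReal (x ^ 2 / (((2 : ℝ) - 2 * Real.cos ((h) * x)) * (1 + x ^ 2)))))))‖ ≤ (k : ℝ) ^ 3 * (D 0).re / M := by
  have hM' : (M : ℂ) ≠ 0 := by exact_mod_cast hM.ne'
  have hh' : (h : ℂ) ≠ 0 := Complex.ofReal_ne_zero.2 hh.ne'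
  -- Step 1: telescoping
  have htel := eq_sub_sum_second_diff (fun j : ℤ => g (j * h)) k
  simp only [Int.cast_natCast, Int.cast_zero, zero_mul, Int.cast_neg, Int.cast_one, neg_mul,
    one_mul, Int.cast_add, Int.cast_sub] at htel
  -- Step 2: the brackets are the data `D`
  have hsumD : ∑ i ∈ Finset.range k, ((k : ℂ) - i) * (2 * g (i * h) - g ((i + 1) * h) -
      g ((i - 1) * h)) = ∑ i ∈ Finset.range k, ((k : ℂ) - i) * D i :=
    Finset.sum_congr rfl fun i hi => by rw [hDd i (Finset.mem_range.1 hi)]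
  rw [hsumD] at htel
  -- Step 3: Fejér coefficients
  have hDi : ∀ i : ℕ, i < k →
      D i = (∫ θ, cexp (-(I * (i : ℂ) * θ)) ∂ν) + ((i : ℂ) / M) * D i := by
    intro i hi
    have hiM : i ≤ M := by omega
    have hc := hcoef (i : ℤ) (by simpa using hiM)
    simp only [Int.natAbs_natCast, Int.cast_natCast] at hc
    rw [hc, Nat.cast_sub hiM]
    field_simp
    ring
  -- Step 4: split the sum
  have hsplit : ∑ i ∈ Finset.range k, ((k : ℂ) - i) * D i =
      (∫ θ, ∑ i ∈ Finset.range k, ((k : ℂ) - i) * cexp (-(I * (i : ℂ) * θ)) ∂ν) +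
        ∑ i ∈ Finset.range k, ((k : ℂ) - i) * (((i : ℂ) / M) * D i) := by
    rw [integral_finsetSum _ (fun i _ => (integrable_cexp_neg i).const_mul _),
      ← Finset.sum_add_distrib]
    refine Finset.sum_congr rfl fun i hi => ?_
    rw [integral_const_mul, ← mul_add, ← hDi i (Finset.mem_range.1 hi)]
  -- Step 5: closed form of the summed kernel, a.e.
  have hS : ∫ θ, ∑ i ∈ Finset.range k, ((k : ℂ) - i) * cexp (-(I * (i : ℂ) * θ)) ∂ν =
      -∫ θ, ((cexp (-(I * (((k : ℤ)) : ℂ) * ((θ) : ℂ))) - 1 - (((k : ℤ)) : ℂ) * (1 - cexp (I * ((θ) : ℂ)))) / (((2 : ℝ) - 2 * Real.cos (θ) : ℝ) : ℂ)) ∂ν := by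
    rw [← integral_neg]
    refine integral_congr_ae ?_
    filter_upwards [ae_good hac hsupp] with θ hθ
    exact sum_geom_kernel_eq hθ.1 hθ.2 k
  -- Step 6: `Q = P - k μ` a.e.
  have hQ : ∫ θ, ((cexp (-(I * (((k : ℤ)) : ℂ) * ((θ) : ℂ))) - 1 - (((k : ℤ)) : ℂ) * (1 - cexp (I * ((θ) : ℂ)))) / (((2 : ℝ) - 2 * Real.cos (θ) : ℝ) : ℂ)) ∂ν =
      (∫ θ, (kreinHelicalIntegrand (((k : ℤ) : ℝ) * h) ((θ) / (h)) * ((((θ) / (h)) ^ 2 / ((2 : ℝ) - 2 * Real.cos (θ)) : ℝ) : ℂ)) ∂ν) - ((k : ℤ) : ℂ) * ∫ θ, (((1 - cexp (I * ((θ) : ℂ))) + I * ((θ) : ℂ) / (((1 : ℝ) + ((θ) / (h)) ^ 2 : ℝ) : ℂ)) / (((2 : ℝ) - 2 * Real.cos (θ) : ℝ) : ℂ)) ∂ν := by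
    rw [← integral_const_mul, ← integral_sub (integrable_transported hh hac hsupp _)
      ((integrable_compensator hh hac hsupp).const_mul _)]
    refine integral_congr_ae ?_
    filter_upwards [ae_good hac hsupp] with θ hθ
    exact kernel_eq_transported_sub hh hθ.2 (k : ℤ)
  -- Step 7: transport to `ρ`
  have hPF := integral_transported_eq (ν := ν) hh (((k : ℤ) : ℝ) * h)
  rw [hPF] at hQ
  simp only [Int.cast_natCast] at hS hQ
  -- Step 8: assemble
  set FI := ∫ x, (kreinHelicalIntegrand (k * h) (x) * (((1 : ℝ) + (x) ^ 2 : ℝ) : ℂ)) ∂((MeasureTheory.Measure.withDensity (MeasureTheory.Measure.map (fun θ : ℝ => θ / (h)) (ν)) (fun x : ℝ => ENNReal.ofReal (x ^ 2 / (((2 : ℝ) - 2 * Real.cos ((h) * x)) * (1 + x ^ 2)))))) with hFI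
  set MU := ∫ θ, (((1 - cexp (I * ((θ) : ℂ))) + I * ((θ) : ℂ) / (((1 : ℝ) + ((θ) / (h)) ^ 2 : ℝ) : ℂ)) / (((2 : ℝ) - 2 * Real.cos (θ) : ℝ) : ℂ)) ∂ν with hMU
  have hlin : (((k : ℝ) * h : ℝ) : ℂ) * (((g 0 - g (-h)) - MU) / (h : ℂ)) =
      (k : ℂ) * ((g 0 - g (-h)) - MU) := by
    push_cast; field_simp
  have hR : g (k * h) - (g 0 + ((k * h : ℝ) : ℂ) * (((g 0 - g (-h)) - MU) / h) + FI) =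
        -∑ i ∈ Finset.range k, ((k : ℂ) - i) * (((i : ℂ) / M) * D i) := by
    rw [hlin, htel, hsplit, hS, hQ]
    ring
  rw [hR, norm_neg]
  -- the error bound
  have hD0 : ∀ i : ℤ, ‖D i‖ ≤ (D 0).re := fun i => IsPositiveDefinite.norm_apply_le_holds hD i
  have hterm : ∀ i ∈ Finset.range k, ‖((k : ℂ) - i) * (((i : ℂ) / M) * D i)‖ ≤
      k * ((k / M) * (D 0).re) := by
    intro i hi
    rw [Finset.mem_range] at hi
    have hik : (i : ℝ) ≤ k := by exact_mod_cast hi.le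
    rw [norm_mul, norm_mul]
    have h1 : ‖(k : ℂ) - i‖ ≤ k := by
      have : (k : ℂ) - i = ((k - i : ℝ) : ℂ) := by push_cast; ring
      rw [this, Complex.norm_real, Real.norm_eq_abs, abs_of_nonneg (by linarith)]
      linarith [(Nat.cast_nonneg i : (0 : ℝ) ≤ i)]
    have h2 : ‖(i : ℂ) / M‖ ≤ k / M := by
      rw [norm_div, Complex.norm_natCast, Complex.norm_natCast]
      gcongr
    have h3 := hD0 i
    have hDre : 0 ≤ (D 0).re := hD.apply_zero_re_nonneg
    exact mul_le_mul h1 (mul_le_mul h2 h3 (norm_nonneg _) (by positivity)) (by positivity)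
      (by positivity)
  calc ‖∑ i ∈ Finset.range k, ((k : ℂ) - i) * (((i : ℂ) / M) * D i)‖
      ≤ ∑ i ∈ Finset.range k, ‖((k : ℂ) - i) * (((i : ℂ) / M) * D i)‖ := norm_sum_le _ _
    _ ≤ ∑ _i ∈ Finset.range k, k * ((k / M) * (D 0).re) := Finset.sum_le_sum hterm
    _ = (k : ℝ) ^ 3 * (D 0).re / M := by
      rw [Finset.sum_const, Finset.card_range, nsmul_eq_mul]; ring

/-- **The lattice coefficient is purely imaginary**: `Re A_h = 0`, from `Re μ_h = 1/2` a.e., the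
total mass `ν(ℝ) = D(0)` (Fejér coefficient at `0`) and `D(0) = 2g(0) - g(h) - g(-h)`,
`g(-h) = conj g(h)`. [folklore] -/
theorem re_latticeCoeff_eq_zero {g : ℝ → ℂ} {D : ℤ → ℂ} {M : ℕ} (hh : 0 < h) (hM : 0 < M)
    (hac : ν ≪ volume) (hsupp : ν (Set.Ioc (-Real.pi) Real.pi)ᶜ = 0)
    (hcoef : ∀ j : ℤ, j.natAbs ≤ M →
      ∫ θ, cexp (-(I * j * θ)) ∂ν = ((M - j.natAbs : ℕ) : ℂ) / M * D j)
    (hD0 : D 0 = 2 * g 0 - g h - g (-h)) (hherm : g (-h) = conj (g h)) :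
    (((g 0 - g (-h)) - ∫ θ, (((1 - cexp (I * ((θ) : ℂ))) + I * ((θ) : ℂ) / (((1 : ℝ) + ((θ) / (h)) ^ 2 : ℝ) : ℂ)) / (((2 : ℝ) - 2 * Real.cos (θ) : ℝ) : ℂ)) ∂ν) / h).re = 0 := by
  have hM' : (M : ℂ) ≠ 0 := by exact_mod_cast hM.ne'
  -- total mass
  have hmass : ((ν.real Set.univ : ℝ) : ℂ) = D 0 := by
    have hc := hcoef 0 (by simp)
    simp only [Int.natAbs_zero, Nat.sub_zero, Int.cast_zero, mul_zero, zero_mul, neg_zero,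
      Complex.exp_zero, div_self hM', one_mul] at hc
    rw [integral_const, Complex.real_smul, mul_one] at hc
    exact hc
  have hmass_re : ν.real Set.univ = (D 0).re := by
    have := congrArg Complex.re hmass; simpa using this
  -- `Re ∫ μ = ν(ℝ)/2`
  have hre : (∫ θ, (((1 - cexp (I * ((θ) : ℂ))) + I * ((θ) : ℂ) / (((1 : ℝ) + ((θ) / (h)) ^ 2 : ℝ) : ℂ)) / (((2 : ℝ) - 2 * Real.cos (θ) : ℝ) : ℂ)) ∂ν).re = ν.real Set.univ * (1 / 2) := by
    have h1 := integral_re (integrable_compensator hh hac hsupp (ν := ν))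
    simp only [RCLike.re_to_complex] at h1
    rw [← h1]
    have h2 : ∫ θ, ((((1 - cexp (I * ((θ) : ℂ))) + I * ((θ) : ℂ) / (((1 : ℝ) + ((θ) / (h)) ^ 2 : ℝ) : ℂ)) / (((2 : ℝ) - 2 * Real.cos (θ) : ℝ) : ℂ))).re ∂ν = ∫ _θ, (1 / 2 : ℝ) ∂ν := by
      refine integral_congr_ae ?_
      filter_upwards [ae_good hac hsupp] with θ hθ
      exact re_compensator_eq hθ.1 hθ.2
    rw [h2, integral_const, smul_eq_mul]
  rw [Complex.div_ofReal_re, div_eq_zero_iff]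
  left
  rw [Complex.sub_re, Complex.sub_re, hre, hmass_re, hD0, hherm]
  simp only [Complex.sub_re, Complex.mul_re, Complex.conj_re]
  norm_num
  ring

end Level

/-! ### The rescaled measure: finiteness and support -/

section Rho

variable {h : ℝ} {ν : Measure ℝ} [IsFiniteMeasure ν]

omit [IsFiniteMeasure ν] in
/-- The rescaled measure `ρ_h` is carried by `|hx| ≤ π` (because `ν` is carried by `(-π, π]`).
[folklore] -/
lemma ae_rho_abs_mul_le (hh : 0 < h) (hsupp : ν (Set.Ioc (-Real.pi) Real.pi)ᶜ = 0) :
    ∀ᵐ x ∂((MeasureTheory.Measure.withDensity (MeasureTheory.Measure.map (fun θ : ℝ => θ / (h)) (ν)) (fun x : ℝ => ENNReal.ofReal (x ^ 2 / (((2 : ℝ) - 2 * Real.cos ((h) * x)) * (1 + x ^ 2)))))), |h * x| ≤ Real.pi := by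
  refine (withDensity_absolutelyContinuous _ _).ae_le ?_
  have hmeas : MeasurableSet {x : ℝ | |h * x| ≤ Real.pi} :=
    measurableSet_le (by fun_prop) measurable_const
  refine (ae_map_iff (by fun_prop : AEMeasurable (fun θ : ℝ => θ / h) ν) hmeas).2 ?_
  have h1 : ∀ᵐ θ ∂ν, θ ∈ Set.Ioc (-Real.pi) Real.pi := by
    rw [ae_iff]
    simpa only [Set.compl_def] using hsupp
  filter_upwards [h1] with θ hθ
  have : h * (θ / h) = θ := by field_simp
  rw [this]
  exact abs_le.2 ⟨hθ.1.le, hθ.2⟩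

/-- The rescaled measure `ρ_h` is finite: its density is at most `π²/(4h²)` almost everywhere.
[folklore] -/
lemma isFiniteMeasure_rho (hh : 0 < h) (hac : ν ≪ volume)
    (hsupp : ν (Set.Ioc (-Real.pi) Real.pi)ᶜ = 0) : IsFiniteMeasure ((MeasureTheory.Measure.withDensity (MeasureTheory.Measure.map (fun θ : ℝ => θ / (h)) (ν)) (fun x : ℝ => ENNReal.ofReal (x ^ 2 / (((2 : ℝ) - 2 * Real.cos ((h) * x)) * (1 + x ^ 2)))))) := by
  have hmeas : MeasurableSet {x : ℝ | ENNReal.ofReal (x ^ 2 / (((2 : ℝ) - 2 * Real.cos (h * x)) *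
      (1 + x ^ 2))) ≤ ENNReal.ofReal (Real.pi ^ 2 / (4 * h ^ 2))} :=
    measurableSet_le (Measurable.ennreal_ofReal (by fun_prop)) measurable_const
  have hae : ∀ᵐ x ∂(Measure.map (fun θ : ℝ => θ / h) ν),
      ENNReal.ofReal (x ^ 2 / (((2 : ℝ) - 2 * Real.cos (h * x)) * (1 + x ^ 2))) ≤
        ENNReal.ofReal (Real.pi ^ 2 / (4 * h ^ 2)) := by
    refine (ae_map_iff (by fun_prop : AEMeasurable (fun θ : ℝ => θ / h) ν) hmeas).2 ?_
    filter_upwards [ae_good hac hsupp] with θ hθ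
    have hθ' : h * (θ / h) = θ := by field_simp
    rw [hθ']
    refine ENNReal.ofReal_le_ofReal ?_
    obtain ⟨-, hcpos⟩ := two_sub_two_cos_pos_of_mem hθ.1 hθ.2
    calc (θ / h) ^ 2 / ((2 - 2 * Real.cos θ) * (1 + (θ / h) ^ 2))
        ≤ (θ / h) ^ 2 / (2 - 2 * Real.cos θ) := by
          apply div_le_div_of_nonneg_left (sq_nonneg _) hcpos
          nlinarith [sq_nonneg (θ / h)]
      _ ≤ Real.pi ^ 2 / (4 * h ^ 2) := sq_div_two_sub_two_cos_le hh hθ.1 hθ.2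
  refine isFiniteMeasure_withDensity (ne_of_lt ?_)
  calc ∫⁻ x, ENNReal.ofReal (x ^ 2 / (((2 : ℝ) - 2 * Real.cos (h * x)) * (1 + x ^ 2)))
        ∂(Measure.map (fun θ : ℝ => θ / h) ν)
      ≤ ∫⁻ _x, ENNReal.ofReal (Real.pi ^ 2 / (4 * h ^ 2)) ∂(Measure.map (fun θ : ℝ => θ / h) ν) :=
        lintegral_mono_ae hae
    _ < ⊤ := by
        rw [lintegral_const]
        exact ENNReal.mul_lt_top ENNReal.ofReal_lt_top (measure_lt_top _ _)

end Rho

/-! ### Small facts about `F` used in the limit -/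

section Fprops

/-- Continuity of `x ↦ F(t, x)`. [folklore] -/
lemma continuous_F (t : ℝ) : Continuous fun x : ℝ => (kreinHelicalIntegrand (t) (x) * (((1 : ℝ) + (x) ^ 2 : ℝ) : ℂ)) :=
  (continuous_kreinHelicalIntegrand_right t).mul (by fun_prop)

/-- The bound `‖F(t, x)‖ ≤ 2t² + 2|t| + 4`. [folklore] -/
lemma norm_F_le (t x : ℝ) : ‖(kreinHelicalIntegrand (t) (x) * (((1 : ℝ) + (x) ^ 2 : ℝ) : ℂ))‖ ≤ 2 * t ^ 2 + 2 * |t| + 4 := by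
  rw [norm_mul, Complex.norm_real, Real.norm_eq_abs, abs_of_pos (by positivity : (0:ℝ) < 1 + x ^ 2)]
  have h := norm_kreinHelicalIntegrand_le t x
  rwa [le_div_iff₀ (by positivity)] at h

/-- Conjugation: `conj F(t, x) = F(-t, x)`. [folklore] -/
lemma conj_F (t x : ℝ) : conj ((kreinHelicalIntegrand (t) (x) * (((1 : ℝ) + (x) ^ 2 : ℝ) : ℂ))) = (kreinHelicalIntegrand (-t) (x) * (((1 : ℝ) + (x) ^ 2 : ℝ) : ℂ)) := by
  rw [map_mul, conj_kreinHelicalIntegrand, Complex.conj_ofReal]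

variable (ρ : Measure ℝ) [IsFiniteMeasure ρ]

omit [IsFiniteMeasure ρ] in
/-- `conj ∫ F(t, x) dρ = ∫ F(-t, x) dρ`. [folklore] -/
lemma conj_integral_F (t : ℝ) : conj (∫ x, (kreinHelicalIntegrand (t) (x) * (((1 : ℝ) + (x) ^ 2 : ℝ) : ℂ)) ∂ρ) = ∫ x, (kreinHelicalIntegrand (-t) (x) * (((1 : ℝ) + (x) ^ 2 : ℝ) : ℂ)) ∂ρ := by
  rw [← integral_conj]
  exact integral_congr_ae (ae_of_all _ fun x => conj_F t x)

/-- `‖∫ F(t, x) dρ‖ ≤ (2t² + 2|t| + 4) ρ(ℝ)`. [folklore] -/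
lemma norm_integral_F_le (t : ℝ) :
    ‖∫ x, (kreinHelicalIntegrand (t) (x) * (((1 : ℝ) + (x) ^ 2 : ℝ) : ℂ)) ∂ρ‖ ≤ (2 * t ^ 2 + 2 * |t| + 4) * ρ.real Set.univ := by
  have h := norm_integral_le_of_norm_le_const (μ := ρ) (f := fun x : ℝ => (kreinHelicalIntegrand (t) (x) * (((1 : ℝ) + (x) ^ 2 : ℝ) : ℂ)))
    (C := 2 * t ^ 2 + 2 * |t| + 4) (ae_of_all _ fun x => norm_F_le t x)
  linarith [h]

end Fprops

/-! ### Mass and tail bounds from the real part of the representation -/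

section Bounds

variable {h : ℝ}

/-- Real part of `F`: `Re F(t, x) = (cos(tx) - 1)(1 + x²)/x²` for `x ≠ 0`. [folklore] -/
lemma re_F_of_ne_zero (t : ℝ) {x : ℝ} (hx : x ≠ 0) :
    ((kreinHelicalIntegrand (t) (x) * (((1 : ℝ) + (x) ^ 2 : ℝ) : ℂ))).re = (Real.cos (t * x) - 1) * (1 + x ^ 2) / x ^ 2 := by
  rw [kreinHelicalIntegrand_of_ne_zero t hx]
  set N : ℂ := cexp (-(I * x * t)) - 1 + I * x * t / (1 + (x : ℂ) ^ 2) with hNdef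
  have hN : N.re = Real.cos (t * x) - 1 := by
    rw [hNdef, show (1 + (x : ℂ) ^ 2) = ((1 + x ^ 2 : ℝ) : ℂ) by push_cast; ring]
    rw [Complex.add_re, Complex.sub_re, Complex.div_ofReal_re, Complex.one_re]
    simp [Complex.exp_re, mul_comm x t]
  rw [show ((x : ℂ) ^ 2) = ((x ^ 2 : ℝ) : ℂ) by push_cast; ring, Complex.re_mul_ofReal,
    Complex.div_ofReal_re, hN]
  ring

/-- Real part of `F` at the origin: `Re F(t, 0) = -t²/2`. [folklore] -/
lemma re_F_zero (t : ℝ) : ((kreinHelicalIntegrand (t) ((0 : ℝ)) * (((1 : ℝ) + ((0 : ℝ)) ^ 2 : ℝ) : ℂ))).re = -t ^ 2 / 2 := by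
  simp only [kreinHelicalIntegrand_zero]
  norm_num
  rw [← Complex.ofReal_pow, Complex.ofReal_re]
  ring

/-- `-2 Re F(t, x) ≥ 2 - 2cos(tx) ≥ 0` for `x ≠ 0`. [folklore] -/
lemma two_sub_two_cos_le_neg_two_re_F (t : ℝ) {x : ℝ} (hx : x ≠ 0) :
    2 - 2 * Real.cos (t * x) ≤ -2 * ((kreinHelicalIntegrand (t) (x) * (((1 : ℝ) + (x) ^ 2 : ℝ) : ℂ))).re := by
  rw [re_F_of_ne_zero t hx]
  have hx2 : 0 < x ^ 2 := by positivity
  rw [show -2 * ((Real.cos (t * x) - 1) * (1 + x ^ 2) / x ^ 2) =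
    (2 - 2 * Real.cos (t * x)) * ((1 + x ^ 2) / x ^ 2) by field_simp; ring]
  have h1 : 1 ≤ (1 + x ^ 2) / x ^ 2 := by rw [le_div_iff₀ hx2]; linarith
  have h0 : 0 ≤ 2 - 2 * Real.cos (t * x) := by linarith [Real.cos_le_one (t * x)]
  nlinarith

/-- `-2 Re F(t, x) ≥ 0` everywhere. [folklore] -/
lemma neg_two_re_F_nonneg (t x : ℝ) : 0 ≤ -2 * ((kreinHelicalIntegrand (t) (x) * (((1 : ℝ) + (x) ^ 2 : ℝ) : ℂ))).re := by
  by_cases hx : x = 0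
  · subst hx; rw [re_F_zero]; nlinarith [sq_nonneg t]
  · exact le_trans (by linarith [Real.cos_le_one (t * x)]) (two_sub_two_cos_le_neg_two_re_F t hx)

/-- Integrability of `F(t, ·)` against a finite measure. [folklore] -/
lemma integrable_F (ρ : Measure ℝ) [IsFiniteMeasure ρ] (t : ℝ) :
    Integrable (fun x : ℝ => (kreinHelicalIntegrand (t) (x) * (((1 : ℝ) + (x) ^ 2 : ℝ) : ℂ))) ρ := by
  refine Integrable.mono' (integrable_const (2 * t ^ 2 + 2 * |t| + 4))
    ((measurable_kreinHelicalIntegrand t).mul (by fun_prop)).aestronglyMeasurable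
    (ae_of_all _ fun x => ?_)
  rw [norm_mul, Complex.norm_real, Real.norm_eq_abs, abs_of_pos (by positivity : (0:ℝ) < 1 + x ^ 2)]
  have h := norm_kreinHelicalIntegrand_le t x
  rwa [le_div_iff₀ (by positivity)] at h

variable {g : ℝ → ℂ} {A : ℂ} {ρ : Measure ℝ} [IsFiniteMeasure ρ]

/-- From the representation at one lattice point: `∫ -2 Re F(t, x) dρ ≤ 2‖g(0) - g(t)‖ + 2ε`
(`t = kh`, using `Re A = 0` and `Re ∫ F = ∫ Re F`). [folklore] -/
lemma integral_neg_two_re_F_le (hA : A.re = 0) {t ε : ℝ}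
    (hrep : ‖g t - (g 0 + (t : ℂ) * A + ∫ x, (kreinHelicalIntegrand (t) (x) * (((1 : ℝ) + (x) ^ 2 : ℝ) : ℂ)) ∂ρ)‖ ≤ ε) :
    ∫ x, -2 * ((kreinHelicalIntegrand (t) (x) * (((1 : ℝ) + (x) ^ 2 : ℝ) : ℂ))).re ∂ρ ≤ 2 * ‖g 0 - g t‖ + 2 * ε := by
  set e := g t - (g 0 + (t : ℂ) * A + ∫ x, (kreinHelicalIntegrand (t) (x) * (((1 : ℝ) + (x) ^ 2 : ℝ) : ℂ)) ∂ρ) with he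
  have hre_int : (∫ x, (kreinHelicalIntegrand (t) (x) * (((1 : ℝ) + (x) ^ 2 : ℝ) : ℂ)) ∂ρ).re = ∫ x, ((kreinHelicalIntegrand (t) (x) * (((1 : ℝ) + (x) ^ 2 : ℝ) : ℂ))).re ∂ρ := by
    have h1 := integral_re (integrable_F ρ t)
    simp only [RCLike.re_to_complex] at h1
    exact h1.symm
  have hsum : (g t).re = (g 0).re + ∫ x, ((kreinHelicalIntegrand (t) (x) * (((1 : ℝ) + (x) ^ 2 : ℝ) : ℂ))).re ∂ρ + e.re := by
    have : g t = g 0 + (t : ℂ) * A + (∫ x, (kreinHelicalIntegrand (t) (x) * (((1 : ℝ) + (x) ^ 2 : ℝ) : ℂ)) ∂ρ) + e := by rw [he]; ring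
    rw [this, Complex.add_re, Complex.add_re, Complex.add_re, Complex.re_ofReal_mul, hA, mul_zero,
      add_zero, hre_int]
  rw [integral_const_mul]
  have h1 : (g 0).re - (g t).re ≤ ‖g 0 - g t‖ := by
    rw [← Complex.sub_re]; exact Complex.re_le_norm _
  have h2 : e.re ≤ ε := (Complex.re_le_norm e).trans hrep
  linarith

/-- Averaging over `k = 1, …, K`: `∫ K⁻¹ ∑_{k<K} (-2 Re F((k+1)h, x)) dρ ≤ 2ω + 2ε`. [folklore] -/
lemma integral_avg_le (hA : A.re = 0) {K : ℕ} (hK : 0 < K) {ε ω : ℝ}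
    (hrep : ∀ k : ℕ, k ≤ K → ‖g (k * h) - (g 0 + ((k * h : ℝ) : ℂ) * A + ∫ x, (kreinHelicalIntegrand (k * h) (x) * (((1 : ℝ) + (x) ^ 2 : ℝ) : ℂ)) ∂ρ)‖ ≤ ε)
    (hω : ∀ k : ℕ, 1 ≤ k → k ≤ K → ‖g 0 - g (k * h)‖ ≤ ω) :
    ∫ x, (K : ℝ)⁻¹ * ∑ k ∈ Finset.range K, (-2 * ((kreinHelicalIntegrand ((k + 1) * h) (x) * (((1 : ℝ) + (x) ^ 2 : ℝ) : ℂ))).re) ∂ρ ≤ 2 * ω + 2 * ε := by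
  have hK' : (0 : ℝ) < K := by exact_mod_cast hK
  have hint : ∀ k : ℕ, Integrable (fun x : ℝ => -2 * ((kreinHelicalIntegrand ((k + 1) * h) (x) * (((1 : ℝ) + (x) ^ 2 : ℝ) : ℂ))).re) ρ := fun k =>
    ((integrable_F ρ _).re.const_mul (-2))
  rw [integral_const_mul, integral_finsetSum _ fun k _ => hint k]
  have hkb : ∀ k ∈ Finset.range K, ∫ x, -2 * ((kreinHelicalIntegrand ((k + 1) * h) (x) * (((1 : ℝ) + (x) ^ 2 : ℝ) : ℂ))).re ∂ρ ≤ 2 * ω + 2 * ε := by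
    intro k hk
    rw [Finset.mem_range] at hk
    have h1 := hrep (k + 1) (by omega)
    have h2 := hω (k + 1) (by omega) (by omega)
    push_cast at h1 h2
    have := integral_neg_two_re_F_le (ρ := ρ) hA (t := (k + 1) * h) (ε := ε) (by
      simpa using h1)
    linarith
  calc (K : ℝ)⁻¹ * ∑ k ∈ Finset.range K, ∫ x, -2 * ((kreinHelicalIntegrand ((k + 1) * h) (x) * (((1 : ℝ) + (x) ^ 2 : ℝ) : ℂ))).re ∂ρ
      ≤ (K : ℝ)⁻¹ * ∑ _k ∈ Finset.range K, (2 * ω + 2 * ε) := by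
        gcongr with k hk
        exact hkb k hk
    _ = 2 * ω + 2 * ε := by
        rw [Finset.sum_const, Finset.card_range, nsmul_eq_mul]; field_simp

/-- The averaged kernel as a function of `x`, rewritten: for `x ≠ 0`,
`K⁻¹ ∑_{k<K} (-2 Re F((k+1)h, x)) ≥ K⁻¹ ∑_{k<K} (2 - 2cos((k+1)(hx)))`. [folklore] -/
lemma avg_kernel_le_avg_F {K : ℕ} (hK : 0 < K) {x : ℝ} (hx : x ≠ 0) :
    (K : ℝ)⁻¹ * ∑ k ∈ Finset.range K, (2 - 2 * Real.cos ((k + 1) * (h * x))) ≤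
      (K : ℝ)⁻¹ * ∑ k ∈ Finset.range K, (-2 * ((kreinHelicalIntegrand ((k + 1) * h) (x) * (((1 : ℝ) + (x) ^ 2 : ℝ) : ℂ))).re) := by
  have hK' : (0 : ℝ) < K := by exact_mod_cast hK
  gcongr with k hk
  have := two_sub_two_cos_le_neg_two_re_F ((k + 1) * h) hx
  rwa [show (k + 1) * h * x = (k + 1) * (h * x) by ring] at this

/-- **Tail bound.** If the representation holds at `kh`, `k ≤ K`, with error `ε`, `Re A = 0`,
`ρ` is carried by `|hx| ≤ π`, and `2π ≤ K h R`, then `ρ {R ≤ |x|} ≤ 2ω + 2ε`. [folklore] -/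
theorem measure_tail_le (hh : 0 < h) (hA : A.re = 0) (hρ : ∀ᵐ x ∂ρ, |h * x| ≤ Real.pi)
    {K : ℕ} (hK : 0 < K) {ε ω : ℝ}
    (hrep : ∀ k : ℕ, k ≤ K → ‖g (k * h) - (g 0 + ((k * h : ℝ) : ℂ) * A + ∫ x, (kreinHelicalIntegrand (k * h) (x) * (((1 : ℝ) + (x) ^ 2 : ℝ) : ℂ)) ∂ρ)‖ ≤ ε)
    (hω : ∀ k : ℕ, 1 ≤ k → k ≤ K → ‖g 0 - g (k * h)‖ ≤ ω) {R : ℝ} (hR : 2 * Real.pi ≤ K * h * R) :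
    (ρ {x | R ≤ |x|}).toReal ≤ 2 * ω + 2 * ε := by
  have hK' : (0 : ℝ) < K := by exact_mod_cast hK
  have havg := integral_avg_le (ρ := ρ) hA hK hrep hω
  refine le_trans ?_ havg
  have hmeas : MeasurableSet {x : ℝ | R ≤ |x|} := measurableSet_le measurable_const (by fun_prop)
  rw [← measureReal_def, ← integral_indicator_one hmeas]
  refine integral_mono_ae ((integrable_const (1 : ℝ)).indicator hmeas)
    ((integrable_finsetSum _ fun k _ => (integrable_F ρ _).re.const_mul (-2)).const_mul _) ?_
  filter_upwards [hρ] with x hxπ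
  by_cases hxR : x ∈ {x : ℝ | R ≤ |x|}
  · rw [Set.indicator_of_mem hxR, Pi.one_apply]
    have hRx : R ≤ |x| := hxR
    have hRpos : 0 < R := by
      have hKh : (0 : ℝ) < K * h := by positivity
      by_contra hR0
      rw [not_lt] at hR0
      have : (K : ℝ) * h * R ≤ 0 := mul_nonpos_of_nonneg_of_nonpos hKh.le hR0
      linarith [Real.pi_pos]
    have hx0 : x ≠ 0 := by
      intro h0; rw [h0, abs_zero] at hRx; linarith
    have hu0 : h * x ≠ 0 := mul_ne_zero hh.ne' hx0
    have hKu : 2 * Real.pi ≤ K * |h * x| := by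
      rw [abs_mul, abs_of_pos hh]
      calc 2 * Real.pi ≤ K * h * R := hR
        _ ≤ K * h * |x| := by gcongr
        _ = K * (h * |x|) := by ring
    exact (one_le_avg_kernel hu0 hxπ hK hKu).trans (avg_kernel_le_avg_F hK hx0)
  · rw [Set.indicator_of_notMem hxR]
    refine mul_nonneg (by positivity) (Finset.sum_nonneg fun k _ => neg_two_re_F_nonneg _ _)

/-- **Central mass bound.** Under the same hypotheses,
`ρ {|x| ≤ (Kh)⁻¹} ≤ (2ω + 2ε) · 6/(Kh)²`. [folklore] -/
theorem measure_ball_le (hh : 0 < h) (hA : A.re = 0) {K : ℕ} (hK : 0 < K) {ε ω : ℝ}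
    (hrep : ∀ k : ℕ, k ≤ K → ‖g (k * h) - (g 0 + ((k * h : ℝ) : ℂ) * A + ∫ x, (kreinHelicalIntegrand (k * h) (x) * (((1 : ℝ) + (x) ^ 2 : ℝ) : ℂ)) ∂ρ)‖ ≤ ε)
    (hω : ∀ k : ℕ, 1 ≤ k → k ≤ K → ‖g 0 - g (k * h)‖ ≤ ω) :
    (ρ {x | |x| ≤ ((K : ℝ) * h)⁻¹}).toReal ≤ (2 * ω + 2 * ε) * (6 / ((K : ℝ) * h) ^ 2) := by
  have hK' : (0 : ℝ) < K := by exact_mod_cast hK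
  have hKh : 0 < (K : ℝ) * h := by positivity
  have havg := integral_avg_le (ρ := ρ) hA hK hrep hω
  have hmeas : MeasurableSet {x : ℝ | |x| ≤ ((K : ℝ) * h)⁻¹} :=
    measurableSet_le (by fun_prop) measurable_const
  -- `(Kh)²/6 · ρ(ball) ≤ ∫ avg`
  have hkey : ((K : ℝ) * h) ^ 2 / 6 * (ρ {x | |x| ≤ ((K : ℝ) * h)⁻¹}).toReal ≤ 2 * ω + 2 * ε := by
    refine le_trans ?_ havg
    rw [← measureReal_def, ← integral_indicator_one hmeas, ← integral_const_mul]
    refine integral_mono_ae (((integrable_const (1 : ℝ)).indicator hmeas).const_mul _)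
      ((integrable_finsetSum _ fun k _ => (integrable_F ρ _).re.const_mul (-2)).const_mul _)
      (ae_of_all _ fun x => ?_)
    dsimp only
    by_cases hxB : x ∈ {x : ℝ | |x| ≤ ((K : ℝ) * h)⁻¹}
    · rw [Set.indicator_of_mem hxB, Pi.one_apply, mul_one]
      have hxle : |x| ≤ ((K : ℝ) * h)⁻¹ := hxB
      have hKu : K * |h * x| ≤ 1 := by
        rw [abs_mul, abs_of_pos hh]
        calc (K : ℝ) * (h * |x|) = (K * h) * |x| := by ring
          _ ≤ (K * h) * ((K : ℝ) * h)⁻¹ := by gcongr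
          _ = 1 := mul_inv_cancel₀ hKh.ne'
      by_cases hx0 : x = 0
      · subst hx0
        simp only [re_F_zero]
        have hsum : ∑ k ∈ Finset.range K, (-2 * (-(((k : ℝ) + 1) * h) ^ 2 / 2)) =
            h ^ 2 * ∑ k ∈ Finset.range K, ((k : ℝ) + 1) ^ 2 := by
          rw [Finset.mul_sum]; exact Finset.sum_congr rfl fun k _ => by ring
        rw [hsum]
        have hc := cube_div_three_le_sum_sq K
        rw [← div_eq_inv_mul, le_div_iff₀ hK']
        nlinarith [mul_le_mul_of_nonneg_left hc (sq_nonneg h)]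
      · have h1 := sq_le_avg_kernel hK hKu
        have h2 := avg_kernel_le_avg_F (h := h) hK hx0
        have h3 : ((K : ℝ) * h) ^ 2 / 6 ≤ (K : ℝ) ^ 2 * (h * x) ^ 2 / 6 * ((1 + x ^ 2) / x ^ 2) := by
          have hx2 : 0 < x ^ 2 := by positivity
          rw [show (K : ℝ) ^ 2 * (h * x) ^ 2 / 6 * ((1 + x ^ 2) / x ^ 2) =
            ((K : ℝ) * h) ^ 2 / 6 * (1 + x ^ 2) by field_simp]
          nlinarith [sq_nonneg ((K : ℝ) * h)]
        -- the average of `-2 Re F` dominates `(1+x²)/x²` times the average kernel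
        have h4 : ((K : ℝ)⁻¹ * ∑ k ∈ Finset.range K, (2 - 2 * Real.cos ((k + 1) * (h * x)))) *
            ((1 + x ^ 2) / x ^ 2) ≤
            (K : ℝ)⁻¹ * ∑ k ∈ Finset.range K, (-2 * ((kreinHelicalIntegrand ((k + 1) * h) (x) * (((1 : ℝ) + (x) ^ 2 : ℝ) : ℂ))).re) := by
          rw [mul_assoc, Finset.sum_mul]
          refine mul_le_mul_of_nonneg_left (Finset.sum_le_sum fun k _ => ?_) (by positivity)
          rw [re_F_of_ne_zero _ hx0]
          have hx2 : 0 < x ^ 2 := by positivity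
          rw [show ((k : ℝ) + 1) * h * x = (k + 1) * (h * x) by ring]
          have : -2 * ((Real.cos ((k + 1) * (h * x)) - 1) * (1 + x ^ 2) / x ^ 2) =
              (2 - 2 * Real.cos ((k + 1) * (h * x))) * ((1 + x ^ 2) / x ^ 2) := by
            field_simp; ring
          rw [this]
        calc ((K : ℝ) * h) ^ 2 / 6 ≤ (K : ℝ) ^ 2 * (h * x) ^ 2 / 6 * ((1 + x ^ 2) / x ^ 2) := h3
          _ ≤ ((K : ℝ)⁻¹ * ∑ k ∈ Finset.range K, (2 - 2 * Real.cos ((k + 1) * (h * x)))) *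
              ((1 + x ^ 2) / x ^ 2) := mul_le_mul_of_nonneg_right h1 (by positivity)
          _ ≤ _ := h4
    · rw [Set.indicator_of_notMem hxB, mul_zero]
      exact mul_nonneg (by positivity) (Finset.sum_nonneg fun k _ => neg_two_re_F_nonneg _ _)
  have hKh2 : (0 : ℝ) < ((K : ℝ) * h) ^ 2 := by positivity
  set m := (ρ {x | |x| ≤ ((K : ℝ) * h)⁻¹}).toReal with hm
  calc m = (((K : ℝ) * h) ^ 2 / 6 * m) * (6 / ((K : ℝ) * h) ^ 2) := by field_simp
    _ ≤ (2 * ω + 2 * ε) * (6 / ((K : ℝ) * h) ^ 2) := by gcongr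

end Bounds

end Literature.Analysis.InverseSpectral
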